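import Mathlib.Analysis.Normed.Unbundled.SpectralNorm
import Mathlib.Analysis.Normed.Module.FiniteDimension
import Literature.NumberTheory.GaloisRepresentations.InertiaRootsOfUnity
import HarnessLib

/-!
# Finite extensions of a non-archimedean local field are non-archimedean local fields

Topic `Literature/NumberTheory/GaloisRepresentations` (companion of `LocalField`, `WeilGroup`).
Serre, *Local Fields*, Ch. II §2, Prop. 3 and Cor. 2: if `K` is complete for a discrete valuation
and `L/K` is a finite extension, the valuation of `K` has a unique prolongation `w` to `L`, and `L`
is complete for `w`; with Ch. II §1, Prop. 1 (a discretely valued field is locally compact iff it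
is complete with finite residue field) a finite extension of a non-archimedean local field is again
a non-archimedean local field (Weil, *Basic Number Theory*, Ch. I §3; Tate, *Number theoretic
background*, (1.4.5), where the Weil groups of all finite `E/F` are used).

Many statements of the tree quantify over "a finite extension `E'/E` of non-archimedean local
fields" as a Type carrying its own instances `[ValuativeRel E'] [TopologicalSpace E']
[IsNonarchimedeanLocalField E'] [ValuativeExtension E E']` (e.g. the inductivity axiom
`Literature.NumberTheory.Automorphic.LocalEpsilonSystem.induction_degree_zero` of the local
constants, `WeilGroup.weilSubgroup_map_absGaloisRestrict_le`, `LocalArtinData.IsCompatible`).  To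
*instantiate* such statements at a concrete finite extension (an intermediate field of `Ē/E`, a
splitting field, …) one needs these structures as definitions.  This file provides them, for any
non-archimedean local field `K` (Mathlib `IsNonarchimedeanLocalField`) and any finite extension
`L` of `K` given as a field with `[Algebra K L] [FiniteDimensional K L]`:

* `FiniteExtension.normedField K L` — `L` as a nontrivially normed field for the **spectral norm**
  (Mathlib `spectralNorm.nontriviallyNormedField`: the unique power-multiplicative `K`-algebra
  norm on `L` extending the absolute value of `K`, Bosch–Güntzer–Remmert 3.2; this is Serre's
  `w`, Cor. 2, written multiplicatively), relative to the valuation norm of `K` (the tree's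
  `IsNonarchimedeanLocalField.nontriviallyNormedField K` of `InertiaRootsOfUnity`, Mathlib
  `Valued.toNontriviallyNormedField` for a chosen rank-one embedding of the value group; its
  topology is the given topology of `K`, `nontriviallyNormedField_toTopologicalSpace`);
* `FiniteExtension.valuativeRel K L`, `FiniteExtension.topologicalSpace K L` — the valuative
  relation `x ≤ᵥ y ↔ ‖x‖ ≤ ‖y‖` (Mathlib `ValuativeRel.ofValuation` of `NormedField.valuation`) and
  the norm topology on `L`;
* `FiniteExtension.isNonarchimedeanLocalField K L` (**proved**) — with these structures `L` is a
  non-archimedean local field: the topology is valuative (`IsValuativeTopology`, from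
  `Valued.mem_nhds_zero` for `NormedField.toValued`), locally compact (`FiniteDimensional.proper`:
  a finite-dimensional normed space over the locally compact complete field `K`), and the
  valuation is non-trivial (it extends that of `K`);
* `FiniteExtension.valuativeExtension K L` (**proved**) — the valuation of `L` prolongs that of
  `K` (`ValuativeExtension K L`; Mathlib `spectralNorm_extends`);
* `FiniteExtension.exists_isNonarchimedeanLocalField` — the existence statement packaging the two;
* unfolding API: `FiniteExtension.vle_iff_norm_le`, `FiniteExtension.norm_algebraMap`,
  `IsNonarchimedeanLocalField.norm_le_norm_iff_vle`,
  `IsNonarchimedeanLocalField.completeSpace_nontriviallyNormedField`,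
  `IsNonarchimedeanLocalField.isUltrametricDist_nontriviallyNormedField`,
  `FiniteExtension.completeSpace`, `FiniteExtension.isUltrametricDist`.

Nothing is stated as a named fact; everything is a definition with a body or a proved theorem.
The structures are `def`s, not instances (an instance "finite extension of a local field" would
loop and would clash with the given structure when `L = K`); users introduce them with
`letI := FiniteExtension.valuativeRel K L` etc.

## Mathlib search

Mathlib (this pin) has `IsNonarchimedeanLocalField` with `CompleteSpace`, `IsRankLeOne`,
`LocallyCompactSpace`, the helper instance `Valued K (ValueGroupWithZero K)`
(`Topology/Algebra/Valued/ValuativeRel`), `Valued.toNontriviallyNormedField`, the spectral norm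
with `spectralNorm.nontriviallyNormedField/normedSpace/completeSpace` and `spectralNorm_extends`
(`Analysis/Normed/Unbundled/SpectralNorm`), `NormedField.valuation/toValued`,
`ValuativeRel.ofValuation`, `IsValuativeTopology.of_mem_nhds_zero_iff_vle`,
`FiniteDimensional.proper`; it has no statement that a finite extension of a local field is a
local field (grep `IsNonarchimedeanLocalField` : only `LocalField/Basic` and `Padics`), and the
tree only has the instance for adic completions of number fields
(`Literature.NumberTheory.Automorphic.AdicCompletionLocalField`) and the valuation norm of the base
(`IsNonarchimedeanLocalField.nontriviallyNormedField`, `InertiaRootsOfUnity`, reused here).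
Nothing here duplicates a Mathlib or tree declaration.

## References

* J.-P. Serre, *Local Fields*, GTM 67 (1979), Ch. II §1 Prop. 1, §2 Prop. 3 and Cor. 2
  (`SerreLocalFields1979`).
* S. Bosch, U. Güntzer, R. Remmert, *Non-Archimedean Analysis* (1984), §3.2 (spectral norm), as
  formalised in Mathlib.
* A. Weil, *Basic Number Theory* (1967), Ch. I §3 (`Weil1967`).
-/

noncomputable section

open ValuativeRel

namespace Literature.NumberTheory.GaloisRepresentations

namespace IsNonarchimedeanLocalField

/-! ### The base field as a complete nontrivially normed field -/

section Base

variable (K : Type*) [Field K] [ValuativeRel K] [TopologicalSpace K] [IsNonarchimedeanLocalField K]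

/-!
The base field `K` is normed by the tree's `IsNonarchimedeanLocalField.nontriviallyNormedField K`
(`InertiaRootsOfUnity`): Mathlib's `Valued.toNontriviallyNormedField` for the additive uniform
structure `IsTopologicalAddGroup.rightUniformSpace K` and the rank-one structure
`rankOneValued K`; we add the four facts about it used below.
-/

/-- The uniform structure of `nontriviallyNormedField K` is the additive uniform structure of `K`
(definitionally); in particular the norm topology is the given topology of `K`.
Ref: Serre, *Local Fields*, Ch. II §1. [folklore] -/
theorem nontriviallyNormedField_toUniformSpace :
    (nontriviallyNormedField K).toUniformSpace = IsTopologicalAddGroup.rightUniformSpace K := rfl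

/-- The norm topology of `nontriviallyNormedField K` is the given topology of `K`.
Ref: Serre, *Local Fields*, Ch. II §1. [folklore] -/
theorem nontriviallyNormedField_toTopologicalSpace :
    (nontriviallyNormedField K).toUniformSpace.toTopologicalSpace = ‹TopologicalSpace K› := rfl

/-- The norm of `nontriviallyNormedField K` is monotone in the valuation:
`‖x‖ ≤ ‖y‖ ↔ x ≤ᵥ y`.  Ref: Serre, *Local Fields*, Ch. II §1 ("`‖x‖ = a^{v(x)}`"). [folklore] -/
theorem norm_le_norm_iff_vle (x y : K) :
    @Norm.norm K (nontriviallyNormedField K).toNorm x ≤ @Norm.norm K (nontriviallyNormedField K).toNorm y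
      ↔ x ≤ᵥ y := by
  letI := IsTopologicalAddGroup.rightUniformSpace K
  haveI := isUniformAddGroup_of_addCommGroup (G := K)
  letI := rankOneValued K
  rw [Valuation.Compatible.vle_iff_le (v := valuation K)]
  exact Valued.toNormedField.norm_le_iff

/-- The norm of `nontriviallyNormedField K`: `‖x‖ < ‖y‖ ↔ ¬ y ≤ᵥ x`.
Ref: Serre, *Local Fields*, Ch. II §1. [folklore] -/
theorem norm_lt_norm_iff_not_vle (x y : K) :
    @Norm.norm K (nontriviallyNormedField K).toNorm x < @Norm.norm K (nontriviallyNormedField K).toNorm y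
      ↔ ¬ y ≤ᵥ x := by
  rw [← norm_le_norm_iff_vle, not_le]

/-- `K` is complete for `nontriviallyNormedField K` (Mathlib: a non-archimedean local field is
complete for any compatible uniform structure).  Ref: Serre, *Local Fields*, Ch. II §1, Prop. 1
("if `K` is locally compact, it is complete"). [cite: SerreLocalFields1979, Ch. II §1 Prop. 1] -/
theorem completeSpace_nontriviallyNormedField :
    @CompleteSpace K (nontriviallyNormedField K).toUniformSpace :=
  letI := IsTopologicalAddGroup.rightUniformSpace K
  haveI := isUniformAddGroup_of_addCommGroup (G := K)
  inferInstanceAs (CompleteSpace K)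

/-- The absolute value of `nontriviallyNormedField K` is ultrametric.
Ref: Serre, *Local Fields*, Ch. II §1. [folklore] -/
theorem isUltrametricDist_nontriviallyNormedField :
    @IsUltrametricDist K (nontriviallyNormedField K).toNormedField.toMetricSpace.toPseudoMetricSpace.toDist := by
  letI := nontriviallyNormedField K
  refine IsUltrametricDist.isUltrametricDist_of_isNonarchimedean_norm ?_
  letI := IsTopologicalAddGroup.rightUniformSpace K
  haveI := isUniformAddGroup_of_addCommGroup (G := K)
  letI := rankOneValued K
  exact Valued.isNonarchimedean_norm K (ValueGroupWithZero K)

end Base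

end IsNonarchimedeanLocalField

/-! ### Finite extensions -/

namespace FiniteExtension

open IsNonarchimedeanLocalField

variable (K : Type*) [Field K] [ValuativeRel K] [TopologicalSpace K] [IsNonarchimedeanLocalField K]
  (L : Type*) [Field L] [Algebra K L] [FiniteDimensional K L]

/-- **The extended absolute value.**  A finite extension `L` of the non-archimedean local field `K`
as a nontrivially normed field for the *spectral norm* of `L/K` — the extension to `L` of the
absolute value of `K` (= `nontriviallyNormedField K`), `‖y‖ = max ‖roots of minpoly_K(y)‖`,
equivalently `‖y‖ = ‖N_{K(y)/K}(y)‖^{1/[K(y):K]}` (Serre, Ch. II §2, Cor. 4: `w = f⁻¹ v ∘ N_{L/K}`);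
Mathlib `spectralNorm.nontriviallyNormedField`, which needs `K` complete and ultrametric.  This is
the unique prolongation of the valuation of `K` (Serre, *Local Fields*, Ch. II §2, Cor. 2;
uniqueness of the prolongation is Mathlib's `spectralNorm_unique`).
[cite: SerreLocalFields1979, Ch. II §2 Prop. 3, Cor. 2] -/
@[implicit_reducible]
def normedField : NontriviallyNormedField L :=
  letI := nontriviallyNormedField K
  haveI : CompleteSpace K := completeSpace_nontriviallyNormedField K
  haveI : IsUltrametricDist K := isUltrametricDist_nontriviallyNormedField K
  spectralNorm.nontriviallyNormedField K L

/-- The extended absolute value is the spectral norm.  Ref: Serre, *Local Fields*, Ch. II §2.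
[folklore] -/
theorem norm_def (y : L) :
    @Norm.norm L (normedField K L).toNorm y = @spectralNorm K (nontriviallyNormedField K).toNormedField L _ _ y :=
  rfl

/-- The extended absolute value prolongs that of `K`: `‖algebraMap K L x‖ = ‖x‖`
(Mathlib `spectralNorm_extends`).  Ref: Serre, *Local Fields*, Ch. II §2, Cor. 2.
[cite: SerreLocalFields1979, Ch. II §2 Cor. 2] -/
theorem norm_algebraMap (x : K) :
    @Norm.norm L (normedField K L).toNorm (algebraMap K L x) =
      @Norm.norm K (nontriviallyNormedField K).toNorm x := by
  letI := nontriviallyNormedField K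
  exact spectralNorm_extends x

/-- The extended absolute value is ultrametric (Mathlib `isNonarchimedean_spectralNorm`).
Ref: Serre, *Local Fields*, Ch. II §2. [folklore] -/
theorem isUltrametricDist :
    @IsUltrametricDist L (normedField K L).toNormedField.toMetricSpace.toPseudoMetricSpace.toDist := by
  letI := nontriviallyNormedField K
  letI := normedField K L
  exact IsUltrametricDist.isUltrametricDist_of_isNonarchimedean_norm isNonarchimedean_spectralNorm

/-- **The valuation of a finite extension**: the valuative relation `x ≤ᵥ y ↔ ‖x‖ ≤ ‖y‖` on `L`
defined by the extended absolute value (Mathlib `ValuativeRel.ofValuation` of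
`NormedField.valuation`).  Ref: Serre, *Local Fields*, Ch. II §2, Prop. 3 and Cor. 2.
[cite: SerreLocalFields1979, Ch. II §2 Prop. 3] -/
@[implicit_reducible]
def valuativeRel : ValuativeRel L :=
  letI := normedField K L
  haveI := isUltrametricDist K L
  ValuativeRel.ofValuation (NormedField.valuation (K := L))

/-- The topology of a finite extension: the norm topology of the extended absolute value (by
Serre, Ch. II §2, proof of Prop. 3, this is the product topology of `L ≅ Kⁿ`).
Ref: Serre, *Local Fields*, Ch. II §2, Prop. 3. [cite: SerreLocalFields1979, Ch. II §2 Prop. 3] -/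
@[implicit_reducible]
def topologicalSpace : TopologicalSpace L :=
  (normedField K L).toUniformSpace.toTopologicalSpace

/-- Unfolding lemma: `x ≤ᵥ y ↔ ‖x‖ ≤ ‖y‖` for the structures of a finite extension.
Ref: Serre, *Local Fields*, Ch. II §2. [folklore] -/
theorem vle_iff_norm_le (x y : L) :
    @ValuativeRel.vle L _ (valuativeRel K L) x y ↔
      @Norm.norm L (normedField K L).toNorm x ≤ @Norm.norm L (normedField K L).toNorm y :=
  Iff.rfl

/-- The norm valuation of `L` is compatible with `valuativeRel K L`.
Ref: Serre, *Local Fields*, Ch. II §2. [folklore] -/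
theorem compatible :
    letI := normedField K L
    haveI := isUltrametricDist K L
    letI := valuativeRel K L
    (NormedField.valuation (K := L)).Compatible := by
  letI := normedField K L
  haveI := isUltrametricDist K L
  exact Valuation.Compatible.ofValuation _

/-- `L` is complete for the extended absolute value (a finite-dimensional normed space over the
complete field `K`; Mathlib `spectralNorm.completeSpace`).
Ref: Serre, *Local Fields*, Ch. II §2, Prop. 3 ("`L` is complete"). [cite: SerreLocalFields1979, Ch. II §2 Prop. 3] -/
theorem completeSpace : @CompleteSpace L (normedField K L).toUniformSpace := by
  letI := nontriviallyNormedField K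
  haveI : CompleteSpace K := completeSpace_nontriviallyNormedField K
  haveI : IsUltrametricDist K := isUltrametricDist_nontriviallyNormedField K
  exact spectralNorm.completeSpace K L

/-- `L` is locally compact for the extended absolute value: a finite-dimensional normed space over
the locally compact field `K` is proper (Mathlib `FiniteDimensional.proper`).
Ref: Serre, *Local Fields*, Ch. II §1 Prop. 1, §2 Prop. 3. [cite: SerreLocalFields1979, Ch. II §2 Prop. 3] -/
theorem locallyCompactSpace : @LocallyCompactSpace L (topologicalSpace K L) := by
  letI := nontriviallyNormedField K
  haveI : CompleteSpace K := completeSpace_nontriviallyNormedField K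
  haveI : IsUltrametricDist K := isUltrametricDist_nontriviallyNormedField K
  letI : NormedAddCommGroup L := spectralNorm.normedAddCommGroup K L
  letI : NormedSpace K L := spectralNorm.normedSpace K L
  haveI : ProperSpace L := FiniteDimensional.proper K L
  exact inferInstanceAs (LocallyCompactSpace L)

/-- The norm topology of `L` is valuative for `valuativeRel K L` (neighbourhoods of `0` are the
sets containing a ball `{‖y‖ < γ}`; Mathlib `Valued.mem_nhds_zero` for `NormedField.toValued` and
`IsValuativeTopology.of_mem_nhds_zero_iff_vle`).  Ref: Serre, *Local Fields*, Ch. II §1–§2. [folklore] -/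
theorem isValuativeTopology :
    @IsValuativeTopology L _ (valuativeRel K L) (topologicalSpace K L) := by
  letI := normedField K L
  haveI := isUltrametricDist K L
  letI := valuativeRel K L
  haveI := compatible K L
  letI : Valued L NNReal := NormedField.toValued
  exact IsValuativeTopology.of_mem_nhds_zero_iff_vle (v := NormedField.valuation (K := L))
    Valued.mem_nhds_zero

/-- The valuation of `L` is non-trivial (it prolongs the non-trivial valuation of `K`).
Ref: Serre, *Local Fields*, Ch. II §2. [folklore] -/
theorem isNontrivial : @ValuativeRel.IsNontrivial L _ (valuativeRel K L) := by
  letI := normedField K L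
  haveI := isUltrametricDist K L
  letI := valuativeRel K L
  haveI := compatible K L
  rw [ValuativeRel.isNontrivial_iff_isNontrivial (NormedField.valuation (K := L))]
  obtain ⟨x, hx⟩ := NormedField.exists_one_lt_norm L
  refine ⟨x, ?_, ?_⟩
  · have h : (0 : ℝ) < ‖x‖ := one_pos.trans hx
    simpa [NormedField.valuation_apply, ← NNReal.coe_pos] using h
  · have h : (1 : ℝ) ≠ ‖x‖ := hx.ne
    intro h1
    apply h
    have := congrArg (fun t : NNReal => (t : ℝ)) h1
    simpa [NormedField.valuation_apply] using this.symm

/-- **A finite extension of a non-archimedean local field is a non-archimedean local field**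
(Serre, *Local Fields*, Ch. II §2, Prop. 3 with §1, Prop. 1; Weil, *Basic Number Theory*,
Ch. I §3): with the extended valuation `valuativeRel K L` and its topology `topologicalSpace K L`,
`L` satisfies Mathlib's `IsNonarchimedeanLocalField` (valuative topology, locally compact,
non-trivially valued). [cite: SerreLocalFields1979, Ch. II §2 Prop. 3] -/
theorem isNonarchimedeanLocalField :
    @IsNonarchimedeanLocalField L _ (valuativeRel K L) (topologicalSpace K L) :=
  letI := valuativeRel K L
  letI := topologicalSpace K L
  haveI := isValuativeTopology K L
  haveI := locallyCompactSpace K L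
  haveI := isNontrivial K L
  {}

/-- **The valuation of `L` prolongs that of `K`** (`ValuativeExtension K L` for
`valuativeRel K L`): `algebraMap K L x ≤ᵥ algebraMap K L y ↔ x ≤ᵥ y`, because the spectral norm
extends the absolute value of `K`.  Ref: Serre, *Local Fields*, Ch. II §2, Cor. 2.
[cite: SerreLocalFields1979, Ch. II §2 Cor. 2] -/
theorem valuativeExtension : @ValuativeExtension K L _ _ _ (valuativeRel K L) _ :=
  letI := valuativeRel K L
  { vle_iff_vle := fun x y => by
      rw [vle_iff_norm_le, norm_algebraMap, norm_algebraMap, norm_le_norm_iff_vle] }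

/-- **Existence form** (Serre, *Local Fields*, Ch. II §2, Prop. 3 and Cor. 2, with §1 Prop. 1):
every finite extension `L` of a non-archimedean local field `K` carries a valuative relation and a
topology making it a non-archimedean local field whose valuation prolongs that of `K`.  (The
witnesses are `valuativeRel K L`, `topologicalSpace K L`.) [cite: SerreLocalFields1979, Ch. II §2 Prop. 3] -/
theorem exists_isNonarchimedeanLocalField :
    ∃ (_ : ValuativeRel L) (_ : TopologicalSpace L),
      IsNonarchimedeanLocalField L ∧ ValuativeExtension K L :=
  ⟨valuativeRel K L, topologicalSpace K L, isNonarchimedeanLocalField K L, valuativeExtension K L⟩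

end FiniteExtension

end Literature.NumberTheory.GaloisRepresentations

end
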